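import Mathlib.MeasureTheory.Function.L2Space
import Mathlib.MeasureTheory.Measure.Lebesgue.VolumeOfBalls
import Literature.Analysis.FluidPDE.ElgindiBlowup
import Literature.Analysis.FluidPDE.TaoEnstrophyLocalisation

/-! # `L¹` mass of the vorticity on a ball against the enstrophy — crux stmt-NavierStokesRegularity-11291 (`CoreLogGas.BlowupIsLocallyDriven`), line registered, stub stub_curlIntegralBall

Registered stub `stub_curlIntegralBall` (`--supports stmt-NavierStokesRegularity-11291`) of the
line `registered` of the crux `CoreLogGas.BlowupIsLocallyDriven` (bookkeeping piece of the
far-field strain bound, glue `farFieldStrain_of_parts`): for a `C¹` field `v : ℝ³ → ℝ³` with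
square-integrable gradient, every centre `x` and radius `r > 0`,

  `∫_{B(x,3r)} ‖curl v‖ ≤ C √(r³) √(∫ ‖Dv‖²)`, `C = 4 √(36 π)`.

Proof. Pointwise `‖curl v y‖ ≤ 4 ‖Dv(y)‖` (in-tree `norm_curl_le_four_mul`), Cauchy–Schwarz against
the constant `1` on the finite measure space `(B(x,3r), dy)` (Mathlib
`integral_mul_le_Lp_mul_Lq_of_nonneg` with `p = q = 2`), the volume `|B(x,3r)| = 36 π r³`
(Mathlib `EuclideanSpace.volume_ball_fin_three`) and the monotonicity `∫_{B} ‖Dv‖² ≤ ∫ ‖Dv‖²`.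
Nothing else is here.
-/

noncomputable section

open Set MeasureTheory Filter Topology Function Metric
open scoped ENNReal NNReal Real

namespace Summit.NavierStokesRegularity.NavierStokesRegularity.Theorems.BlowupIsLocallyDriven.Registered

open Literature.Analysis.FluidPDE

-- The summit namespace `Summit.NavierStokesRegularity.NavierStokesRegularity.…` is fixed by the
-- route (problem and summit share the name), so the duplicated component is intended.
set_option linter.dupNamespace false

/-- **Cauchy–Schwarz against the constant `1` on a finite measure space**: for `0 ≤ g ∈ L²(μ)`,
`∫ g dμ ≤ √(μ(univ)) · √(∫ g² dμ)` (Hölder with `p = q = 2`, `f ≡ 1`). [folklore] -/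
theorem curlIntegralBall_integral_le_sqrt_measureReal_mul_sqrt {α : Type*} [MeasurableSpace α]
    {μ : Measure α} [IsFiniteMeasure μ] {g : α → ℝ} (hg0 : ∀ x, 0 ≤ g x) (hg : MemLp g 2 μ) :
    ∫ x, g x ∂μ ≤ Real.sqrt (μ.real univ) * Real.sqrt (∫ x, g x ^ 2 ∂μ) := by
  -- adapted from `Torus.integral_le_sqrt_integral_sq_of_memLp_two` (TwoPointSliceBounds.lean)
  have h := integral_mul_le_Lp_mul_Lq_of_nonneg (μ := μ) Real.HolderConjugate.two_two
    (f := fun _ => (1 : ℝ)) (g := g)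
    (Eventually.of_forall fun _ => zero_le_one) (Eventually.of_forall hg0)
    (by rw [ENNReal.ofReal_ofNat]; exact memLp_const _) (by rw [ENNReal.ofReal_ofNat]; exact hg)
  simp only [one_mul, Real.rpow_two, one_pow, integral_const, smul_eq_mul, mul_one] at h
  rwa [← Real.sqrt_eq_rpow, ← Real.sqrt_eq_rpow] at h

/-- **stub F3 — `stub_curlIntegralBall` (Cauchy–Schwarz).** `∫_{B(x,3r)} ‖curl v‖ ≤ C √(r³) ‖∇v‖_{L²}`
for a `C¹` field `v : ℝ³ → ℝ³` with square-integrable gradient, with the absolute constant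
`C = 4 √(36 π)`: `‖curl v‖ ≤ 4 ‖Dv‖` pointwise (in-tree `norm_curl_le_four_mul`), Cauchy–Schwarz
on the ball of volume `36 π r³`, and `∫_{B} ‖Dv‖² ≤ ∫ ‖Dv‖²`. [folklore] -/
theorem stub_curlIntegralBall :
    ∃ C : ℝ, 0 ≤ C ∧ ∀ (v : EuclideanSpace ℝ (Fin 3) → EuclideanSpace ℝ (Fin 3)),
      ContDiff ℝ 1 v → MeasureTheory.Integrable (fun y => ‖fderiv ℝ v y‖ ^ 2) MeasureTheory.volume →
      ∀ (x : EuclideanSpace ℝ (Fin 3)) (r : ℝ), 0 < r →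
        ∫ y in Metric.ball x (3 * r), ‖Literature.Analysis.FluidPDE.curl v y‖ ≤
          C * Real.sqrt (r ^ 3) * Real.sqrt (∫ y, ‖fderiv ℝ v y‖ ^ 2) := by
  refine ⟨4 * Real.sqrt (36 * π), by positivity, fun v hv hint x r hr => ?_⟩
  set B : Set (EuclideanSpace ℝ (Fin 3)) := Metric.ball x (3 * r) with hB
  haveI : IsFiniteMeasure ((volume : Measure (EuclideanSpace ℝ (Fin 3))).restrict B) :=
    isFiniteMeasure_restrict.2 measure_ball_lt_top.ne
  have hDc : Continuous (fderiv ℝ v) := hv.continuous_fderiv one_ne_zero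
  -- `‖Dv‖ ∈ L²(B)`
  have hmem : MemLp (fun y => ‖fderiv ℝ v y‖) 2 (volume.restrict B) := by
    rw [memLp_two_iff_integrable_sq hDc.norm.aestronglyMeasurable]
    exact hint.restrict
  -- pointwise bound `‖curl v‖ ≤ 4 ‖Dv‖`, integrated over `B`
  have h1 : ∫ y in B, ‖curl v y‖ ≤ ∫ y in B, 4 * ‖fderiv ℝ v y‖ :=
    integral_mono_of_nonneg (Eventually.of_forall fun _ => norm_nonneg _)
      ((hmem.integrable one_le_two).const_mul 4)
      (Eventually.of_forall fun y => norm_curl_le_four_mul v y)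
  -- Cauchy–Schwarz on `B`
  have h2 : ∫ y in B, ‖fderiv ℝ v y‖ ≤
      Real.sqrt ((volume.restrict B).real univ) * Real.sqrt (∫ y in B, ‖fderiv ℝ v y‖ ^ 2) :=
    curlIntegralBall_integral_le_sqrt_measureReal_mul_sqrt (fun _ => norm_nonneg _) hmem
  -- the volume of `B = B(x, 3r)` is `36 π r³`
  have h3 : ((volume : Measure (EuclideanSpace ℝ (Fin 3))).restrict B).real univ =
      36 * π * r ^ 3 := by
    rw [measureReal_restrict_apply_univ, measureReal_def, hB,
      EuclideanSpace.volume_ball_fin_three, ← ENNReal.ofReal_pow (by positivity),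
      ← ENNReal.ofReal_mul (by positivity), ENNReal.toReal_ofReal (by positivity)]
    ring
  -- monotonicity in the domain of integration
  have h4 : ∫ y in B, ‖fderiv ℝ v y‖ ^ 2 ≤ ∫ y, ‖fderiv ℝ v y‖ ^ 2 :=
    setIntegral_le_integral hint (Eventually.of_forall fun _ => sq_nonneg _)
  have h5 : ∫ y in B, ‖fderiv ℝ v y‖ ≤
      Real.sqrt (36 * π) * Real.sqrt (r ^ 3) * Real.sqrt (∫ y, ‖fderiv ℝ v y‖ ^ 2) := by
    calc ∫ y in B, ‖fderiv ℝ v y‖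
        ≤ Real.sqrt ((volume.restrict B).real univ) * Real.sqrt (∫ y in B, ‖fderiv ℝ v y‖ ^ 2) := h2
      _ = Real.sqrt (36 * π) * Real.sqrt (r ^ 3) * Real.sqrt (∫ y in B, ‖fderiv ℝ v y‖ ^ 2) := by
          rw [h3, Real.sqrt_mul (by positivity)]
      _ ≤ Real.sqrt (36 * π) * Real.sqrt (r ^ 3) * Real.sqrt (∫ y, ‖fderiv ℝ v y‖ ^ 2) := by
          gcongr
  calc ∫ y in B, ‖curl v y‖ ≤ ∫ y in B, 4 * ‖fderiv ℝ v y‖ := h1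
    _ = 4 * ∫ y in B, ‖fderiv ℝ v y‖ := integral_const_mul _ _
    _ ≤ 4 * (Real.sqrt (36 * π) * Real.sqrt (r ^ 3) * Real.sqrt (∫ y, ‖fderiv ℝ v y‖ ^ 2)) := by
        gcongr
    _ = 4 * Real.sqrt (36 * π) * Real.sqrt (r ^ 3) * Real.sqrt (∫ y, ‖fderiv ℝ v y‖ ^ 2) := by
        ring

end Summit.NavierStokesRegularity.NavierStokesRegularity.Theorems.BlowupIsLocallyDriven.Registered
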